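import Summits.AtomisticToContinuum.FouriersLaw.Theorems.EmbeddedDrudeMourreAbelThermodynamicLimitDynamicalMatchingPathwise
import Summits.AtomisticToContinuum.FouriersLaw.Theorems.EmbeddedDrudeMourreAbelThermodynamicLimitDynamicalMatchingEnergyMean
import Summits.AtomisticToContinuum.FouriersLaw.Theorems.EmbeddedDrudeMourreAbelThermodynamicLimitDynamicalMatchingBadEvent
import Summits.AtomisticToContinuum.FouriersLaw.Theorems.EmbeddedDrudeMourreAbelThermodynamicLimitDynamicalMatchingRadius

/-!
# Leaf (B₀) `stub_fixedTimeOffsetMatching` of S4: the DYNAMIC half `stub_centralWindowDynamicalMatching` — PROVED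
(crux `EmbeddedDrudeMourre.AbelThermodynamicLimit`, item stmt-AtomisticToContinuum-12596, line
`loomis-compact-horizon-witness`; `--supports` file proving the registered sub-goal `stub_centralWindowDynamicalMatching`
VERBATIM; closes nothing)

The registered dynamic half of (B₀): for `P = pinnedChain ω₂ lam β γ` (all `> 0`), `T > 0`, the centred embedding
`ι_N`, `t ≥ 0`, an offset `x` and `ε > 0` there is `R₀` such that for all `R ≥ R₀` and all `N ≥ 2R + 4` the bond
current `j_x` of the embedded open-chain path at time `t` and of the severed Hamiltonian flow of the centred box
`{-R,…,R}` started from the same Gibbs configuration differ by more than `ε` with probability `≤ ε` under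
`gibbsMeasure N T ⊗ W` — the two-dynamics LIGHT CONE at fixed time, uniformly in `N`.

Proof: outside the bad event (local energy `W_{0,R+1}(ι_N z) > lam R²/4` or some time-integrated squared momentum of
the window `> R`; probability `O(1/R)` uniformly in `N`, parts 2–3) both flows keep the window positions in
`[-(2+2t)√R, (2+2t)√R]` (part 3), so the centred pathwise core (part 1: second-order Dobrushin–Fritz iteration inward
from the outer neighbours `±(R+1)`, frozen for the severed flow and moving for the open chain) bounds the discrepancy at
the sites `x, x+1` by `O(R 4^{-(R-|x|)})` in the regime `2e√Θ t ≤ 2(R-|x|) - 1`, `Θ = O(R)`; the local Lipschitz bound of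
`j_x` and the severed momentum bound `√(lam/2) R` turn this into a current error `O(R⁴4^{-R})`; the radius threshold of
part 4 makes regime, current error `≤ ε` and probability `≤ ε` hold for `R ≥ R₀`. Quartic pinning (`lam > 0`) is what
makes the Lipschitz constant `Θ` grow only like `R` (positions `≲ W^{1/4}`).

All statements proved; `[folklore]`. No definitions.
-/

noncomputable section

namespace Summit.AtomisticToContinuum.FouriersLaw.Theorems.AbelThermodynamicLimit.LoomisCompactHorizonWitness

open MeasureTheory ProbabilityTheory Set Filter Topology Function
open scoped NNReal ENNReal
open Literature.MathematicalPhysics.KineticTheory Literature.MathematicalPhysics.KineticTheory.HeatConduction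
open Literature.Probability.Process OscillatorChain
open Summit.AtomisticToContinuum.FouriersLaw.Theorems.NonBallistic
/-! ### §1 The dynamic half -/

/-- **Registered dynamic half `stub_centralWindowDynamicalMatching` of leaf (B₀), line `loomis-compact-horizon-witness` —
THE TWO-DYNAMICS LIGHT CONE AT FIXED TIME, uniformly in `N`** (see the module docstring for the scheme). [folklore] -/
theorem stub_centralWindowDynamicalMatching :
    ∀ ω₂ lam β γ : ℝ, 0 < ω₂ → 0 < lam → 0 < β → 0 < γ → ∀ T : ℝ, 0 < T →
      ∀ (hB1 : (Literature.MathematicalPhysics.KineticTheory.HeatConduction.pinnedChain ω₂ lam β γ).CondB1)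
        (ι : (N : ℕ) → Literature.MathematicalPhysics.KineticTheory.HeatConduction.PhaseSpace N →
          Literature.MathematicalPhysics.KineticTheory.HeatConduction.ChainConfig),
        (∀ (N : ℕ) (z : Literature.MathematicalPhysics.KineticTheory.HeatConduction.PhaseSpace N) (i : ℤ),
          ι N z i = if h : 0 ≤ i + ((N - 1) / 2 : ℕ) ∧ i + ((N - 1) / 2 : ℕ) < N then
            (z.1 ⟨(i + ((N - 1) / 2 : ℕ)).toNat, by omega⟩, z.2 ⟨(i + ((N - 1) / 2 : ℕ)).toNat, by omega⟩)
            else (0, 0)) →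
      ∀ (t : ℝ), 0 ≤ t → ∀ (x : ℤ) (ε : ℝ), 0 < ε → ∃ R₀ : ℕ, ∀ R : ℕ, R₀ ≤ R → ∀ N : ℕ, 2 * R + 4 ≤ N →
        (((Literature.MathematicalPhysics.KineticTheory.HeatConduction.pinnedChain ω₂ lam β γ).gibbsMeasure N T).prod
            Literature.Probability.Process.wienerPair)
          {q : Literature.MathematicalPhysics.KineticTheory.HeatConduction.PhaseSpace N ×
              Literature.Probability.Process.WienerPair |
            ε < |(Literature.MathematicalPhysics.KineticTheory.HeatConduction.pinnedChain ω₂ lam β γ).bondCurrentZ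
                  (ι N ((Literature.MathematicalPhysics.KineticTheory.HeatConduction.pinnedChain ω₂ lam β γ).solMap
                    N T T t q.1 (Literature.Probability.Process.pairPath q.2))) x -
                (Literature.MathematicalPhysics.KineticTheory.HeatConduction.pinnedChain ω₂ lam β γ).bondCurrentZ
                  (Literature.MathematicalPhysics.KineticTheory.HeatConduction.OscillatorChain.severedFlow hB1
                    (Finset.Icc (-(R : ℤ)) R) t (ι N q.1)) x|} ≤ ENNReal.ofReal ε  := by
  intro ω₂ lam β γ hω hl hβ hγ T hT hB1 ι hι t ht x ε hε
  -- the `N`-uniform energy constant and the radius threshold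
  obtain ⟨C, hCtop, hC⟩ := exists_lintegral_bmLocalEnergy_centred_le hω hl hβ hT γ ι hι
  obtain ⟨R₀, hR₀⟩ := exists_radius_threshold hω.le hl hβ.le ht x hε (Cr := C.toReal) (Kt := 2027025 * T ^ 8 * t ^ 8)
    ENNReal.toReal_nonneg (by positivity)
  refine ⟨R₀, fun R hR N hRN => ?_⟩
  obtain ⟨hRx, hR1, hreg, herr, hprob⟩ := hR₀ R hR
  haveI hμ : IsProbabilityMeasure ((pinnedChain ω₂ lam β γ).gibbsMeasure N T) :=
    pinnedChain_isProbabilityMeasure_gibbsMeasure hω hl.le hβ.le γ N hT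
  -- the bad event
  set Bad : Set (PhaseSpace N × WienerPair) :=
    {q | lam * (R : ℝ) ^ 2 / 4 < (pinnedChain ω₂ lam β γ).bmLocalEnergy 0 (R + 1) (ι N q.1)} ∪
      ⋃ m ∈ (Finset.univ.filter fun m : Fin N =>
          -((R : ℤ) + 1) ≤ (m : ℤ) - ((N - 1) / 2 : ℕ) ∧ (m : ℤ) - ((N - 1) / 2 : ℕ) ≤ (R : ℤ) + 1),
        {q | (R : ℝ) < ∫ r in (0:ℝ)..t, ((pinnedChain ω₂ lam β γ).solMap N T T r q.1 (pairPath q.2)).2 m ^ 2}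
    with hBad
  -- on the complement of the bad event the currents are `ε`-close
  have hgood : ∀ q : PhaseSpace N × WienerPair, q ∉ Bad →
      |(pinnedChain ω₂ lam β γ).bondCurrentZ (ι N ((pinnedChain ω₂ lam β γ).solMap N T T t q.1 (pairPath q.2))) x -
        (pinnedChain ω₂ lam β γ).bondCurrentZ (severedFlow hB1 (Finset.Icc (-(R : ℤ)) R) t (ι N q.1)) x| ≤ ε := by
    intro q hq
    simp only [hBad, Set.mem_union, Set.mem_setOf_eq, Set.mem_iUnion, not_or, not_lt, not_exists] at hq
    obtain ⟨hW, hX⟩ := hq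
    have hX' : ∀ m : Fin N, -((R : ℤ) + 1) ≤ (m : ℤ) - ((N - 1) / 2 : ℕ) → (m : ℤ) - ((N - 1) / 2 : ℕ) ≤ (R : ℤ) + 1 →
        ∫ r in (0:ℝ)..t, ((pinnedChain ω₂ lam β γ).solMap N T T r q.1 (pairPath q.2)).2 m ^ 2 ≤ R := by
      intro m h1 h2
      have h := hX m
      simp only [Finset.mem_filter, Finset.mem_univ, true_and] at h
      exact h ⟨h1, h2⟩
    obtain ⟨hbox, hpsev⟩ := good_event_bounds hω hl hβ.le hγ.le hB1 ι hι hRN hR1 T ht q hW hX'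
    -- the open path in `chainFlow` form
    have hsol : ∀ s : ℝ, (pinnedChain ω₂ lam β γ).solMap N T T s q.1 (pairPath q.2) =
        (pinnedChain ω₂ lam β γ).chainFlow N q.1 (chainNoise N (Real.sqrt (2 * (pinnedChain ω₂ lam β γ).γ * T))
          (Real.sqrt (2 * (pinnedChain ω₂ lam β γ).γ * T)) (pairPath q.2)) s := fun s => rfl
    set ρ : ℝ := (2 + 2 * t) * Real.sqrt R with hρdef
    have hcore := fun (i : ℤ) (hi1 : x ≤ i) (hi2 : i ≤ x + 1) =>
      centred_core_estimate hω hl.le hβ.le hγ.le hB1 ι hι q.1 _ _ (pairPath q.2) hRN (ρ := ρ) ht hbox x hRx hreg i hi1 hi2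
    rw [hsol t]
    set X := ι N ((pinnedChain ω₂ lam β γ).chainFlow N q.1 (chainNoise N (Real.sqrt (2 * (pinnedChain ω₂ lam β γ).γ * T))
      (Real.sqrt (2 * (pinnedChain ω₂ lam β γ).γ * T)) (pairPath q.2)) t) with hXdef
    set Y := severedFlow hB1 (Finset.Icc (-(R : ℤ)) R) t (ι N q.1) with hYdef
    obtain ⟨hq0, hp0⟩ := hcore x le_rfl (by omega)
    obtain ⟨hq1, hp1⟩ := hcore (x + 1) (by omega) le_rfl
    have hxR : x ∈ Finset.Icc (-(R : ℤ)) R := by simp only [Finset.mem_Icc]; omega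
    have hxR' : x + 1 ∈ Finset.Icc (-(R : ℤ)) R := by simp only [Finset.mem_Icc]; omega
    obtain ⟨hX0, hY0⟩ := hbox t ⟨ht, le_rfl⟩ x (by omega) (by omega)
    obtain ⟨hX1, hY1⟩ := hbox t ⟨ht, le_rfl⟩ (x + 1) (by omega) (by omega)
    have hj := abs_bondCurrentZ_sub_le ω₂ lam hβ.le γ (σ₁ := X) (σ₂ := Y) (x := x) hX0 hX1 hY0 hY1
      (hpsev x hxR) (hpsev (x + 1) hxR') hp0 hp1 hq0 hq1
    exact hj.trans herr
  -- the probability of the bad event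
  have hsub : {q : PhaseSpace N × WienerPair |
      ε < |(pinnedChain ω₂ lam β γ).bondCurrentZ (ι N ((pinnedChain ω₂ lam β γ).solMap N T T t q.1 (pairPath q.2))) x -
        (pinnedChain ω₂ lam β γ).bondCurrentZ (severedFlow hB1 (Finset.Icc (-(R : ℤ)) R) t (ι N q.1)) x|} ⊆ Bad := by
    intro q hq
    by_contra h
    exact absurd (hgood q h) (not_le.2 hq)
  refine (measure_mono hsub).trans ((bad_event_le hω hl hβ hγ hT ι hι hC hRN hR1 ht).trans ?_)
  -- convert the `ℝ≥0∞` bound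
  have hr1 : (1 : ℝ) ≤ R := by exact_mod_cast hR1
  have hr0 : (0 : ℝ) < R := by linarith
  have hE0 : 0 < lam * (R : ℝ) ^ 2 / 4 := by positivity
  have e1 : (2 * (R : ℝ≥0∞) + 3) = ENNReal.ofReal (2 * R + 3) := by
    rw [ENNReal.ofReal_add (by positivity) (by norm_num), ENNReal.ofReal_mul (by norm_num), ENNReal.ofReal_ofNat,
      ENNReal.ofReal_natCast, ENNReal.ofReal_ofNat]
  have e2 : C = ENNReal.ofReal C.toReal := (ENNReal.ofReal_toReal hCtop).symm
  rw [e1, e2, ← ENNReal.ofReal_mul (by positivity), ← ENNReal.ofReal_div_of_pos hE0,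
    ← ENNReal.ofReal_mul (by positivity), ← ENNReal.ofReal_add (by positivity) (by positivity)]
  exact ENNReal.ofReal_le_ofReal hprob
end Summit.AtomisticToContinuum.FouriersLaw.Theorems.AbelThermodynamicLimit.LoomisCompactHorizonWitness

end
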